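import Summits.ResolutionOfSingularities.ResolutionOfSingularities.Theorems.MarkedTransferCampaignW46PlaneProcrastinationTail
import Summits.ResolutionOfSingularities.ResolutionOfSingularities.Theorems.MarkedTransferCampaignW46PlaneProcrastinationFinite
import Summits.ResolutionOfSingularities.ResolutionOfSingularities.Theorems.MarkedTransferCampaignW46PlaneProcrastination
import Summits.ResolutionOfSingularities.ResolutionOfSingularities.Theorems.MarkedTransferCampaignW46ThreefoldsGammaFreeGlobalSurfaces
import Literature.AlgebraicGeometry.Resolution.AlterationsCurves
import HarnessLib

/-!
# [OURS · L1 W4.6 rung (i-b)] «PROCRASTINATION IS THE ONLY OBSTRUCTION ON SURFACES» — the rung holds: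
# `planeNonProcrastinatingTerminates_holds`
# (cell res-hironaka, LADDER-RESOLUTION rung L, D-0089; campaign s46, prover res-L1-s46-pv-1; host route MarkedTransfer,
# `--supports stmt-ResolutionOfSingularities-16155`)

HONEST FRAMING. Nothing here is a statement of H. Hironaka's manuscript (2017-03-23, [Hironaka2017]); it settles the OURS rung
`PlaneNonProcrastinatingTerminates` (`…PlaneProcrastination.lean`, p515754): there is NO infinite §2.1-permissible sequence of
standard ideal exponents on ambient surfaces (`topologicalKrullDim Z_k ≤ 2`) none of whose steps procrastinates (blows up a closed
point lying on a curve of the singular locus). Every field `K : Type` of characteristic `p`. AI-written; weaker than expert review.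
No `sorry`; axioms standard.

## The proof (Zariski's measure, made résumé-free)

Classify step `k` by the generic point `η_k` of its (irreducible, regular) centre `D_k ⊆ Sing(E_k)`: either `η_k` is closed
(`D_k = {η_k}`, a POINT STEP — non-procrastinating by hypothesis) or not (then `codim η_k = 1`, a CURVE STEP, and the blow-up is an
isomorphism, `isIso_of_curveCentre`). The ambient dimension is constant along the sequence; on curves every stage has isolated
singular locus and rung (i-a) (`planeIsolatedFinLocalExitBound_holds`, res-L1-s46-pv-9) ends the sequence. On surfaces the pair
`(Σ_y μ(y), Σ_ζ ord_ζ J)` — the POINT MEASURE SUM of the loose germ measures `μ` (`looseGermMeasure`: the exit count of the loose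
quadratic tree of the normal form of the stalk, `…PlaneProcrastinationCentre.lean`) over the finitely many points where it is
positive (`finite_setOf_looseGermMeasure_pos`), and the DIVISORIAL SUM (`divisorialSum`, `…PlaneProcrastinationTail.lean`) — drops
lexicographically at every step: at a point step the point measure sum drops (centre law `looseGermMeasure_centre_lt` over the
centre, `looseGermMeasure_offCentre_eq` elsewhere), at a curve step it does not increase (`looseGermMeasure_curveStep_eq`) while the
divisorial sum drops (`divisorialSum_transform_lt_of_curveCentre`). `ℕ ×ₗ ℕ` is well founded.

## References

* O. Zariski, P. Samuel, Commutative Algebra II (1960), Appendix 5. [ZariskiSamuel1960]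
* V. Cossart, O. Piltant, J. Algebra 320 (2008), proof of Prop. 4.2. [CossartPiltant2008]
-/

noncomputable section

set_option linter.dupNamespace false -- mandated namespace of this single-conjunct summit

open CategoryTheory AlgebraicGeometry TopologicalSpace IsLocalRing

namespace Summit.ResolutionOfSingularities.ResolutionOfSingularities.Theorems

namespace CampaignW46

open Literature.AlgebraicGeometry.Resolution
open Literature.AlgebraicGeometry.Hironaka2017.S02Preliminaries
open Scheme.IdealSheafData

universe u

/-! ## Step classification and dimension -/

section Classification

variable {p : ℕ} [Fact p.Prime] {K : Type u} [Field K] [CharP K p]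

/-- `Sing(E) ⊆ V(J)` for `b ≥ 1`. [folklore] -/
theorem sing_le_support {Z : Scheme.{u}} (E : IdealExponent Z) (hb : 0 < E.b) : E.sing ⊆ (E.J.support : Set Z) :=
  fun x hx => (mem_support_iff_stalkIdeal_le E.J x).mpr
    (((mem_sing_iff_stalkIdeal_le_pow E x).mp hx).trans (Ideal.pow_le_self hb.ne'))

/-- An isomorphism of schemes preserves the dimension. [folklore] -/
theorem topologicalKrullDim_eq_of_isIso {X Y : Scheme.{u}} (π : X ⟶ Y) [IsIso π] :
    topologicalKrullDim X = topologicalKrullDim Y :=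
  IsHomeomorph.topologicalKrullDim_eq _ (Scheme.homeoOfIso (asIso π)).isHomeomorph

/-- **Curve steps have codimension-one generic point.** On an ambient scheme of dimension `≤ 2`, the generic point `η` of
a §2.1-permissible centre of a standard `E` which is NOT a closed point has `codim η = 1`: `η ∈ Sing(E) ⊆ V(J)` is not the
generic point of `Z` (`J ≠ 0`), and a strict specialisation of `η` has codimension `≥ codim η + 1` and `≤ 2`. [folklore] -/
theorem coheight_eq_one_of_not_isClosed (A : AmbientDatum p K) {E : IdealExponent A.Z} (hE : E.IsStandard)
    (hdimZ : topologicalKrullDim A.Z ≤ 2) {D : Closeds A.Z} (hD : E.IsPermissibleCentre A.hom D) {η : A.Z}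
    (hη : IsGenericPoint η (D : Set A.Z)) (hncl : ¬ IsClosed ({η} : Set A.Z)) : Order.coheight η = 1 := by
  haveI := ambient_isIntegral A
  have hηsupp : η ∈ (E.J.support : Set A.Z) := sing_le_support E hE.2 (hD.subset_sing hη.mem)
  have hne0 : Order.coheight η ≠ 0 := by
    intro h0
    have h := eq_genericPoint_of_coheight_eq_zero h0
    rw [h] at hηsupp
    exact not_mem_support_genericPoint hE.1 hηsupp
  -- a strict specialisation of `η`
  obtain ⟨x, hxcl, hxne⟩ : ∃ x, x ∈ closure ({η} : Set A.Z) ∧ x ∉ ({η} : Set A.Z) := by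
    have hss : ({η} : Set A.Z) ⊂ closure {η} :=
      subset_closure.ssubset_of_ne fun h => hncl (by rw [h]; exact isClosed_closure)
    exact Set.exists_of_ssubset hss
  rw [Set.mem_singleton_iff] at hxne
  have hsp : η ⤳ x := specializes_iff_mem_closure.mpr hxcl
  have hlt : x < η := lt_of_le_not_ge (Scheme.le_iff_specializes.mpr hsp) fun h' =>
    hxne (Specializes.antisymm (Scheme.le_iff_specializes.mp h') hsp).eq
  have h1 : Order.coheight η + 1 ≤ Order.coheight x := Order.coheight_add_one_le hlt
  have h2 : ((Order.height x + Order.coheight x : ℕ∞) : WithBot ℕ∞) ≤ 2 :=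
    (coe_height_add_coheight_le_topologicalKrullDim x).trans hdimZ
  have h3 : Order.height x + Order.coheight x ≤ 2 := WithBot.coe_le_coe.mp h2
  have h4 : Order.coheight η + 1 ≤ 2 := h1.trans (le_add_self.trans h3)
  have hfin : Order.coheight η ≠ ⊤ := by
    intro ht; rw [ht] at h4; simp at h4
  obtain ⟨c, hc⟩ := ENat.ne_top_iff_exists.mp hfin
  rw [← hc] at h4 hne0 ⊢
  have h5 : c + 1 ≤ 2 := by exact_mod_cast h4
  have h6 : c ≠ 0 := fun h => hne0 (by rw [h]; rfl)
  have h7 : c = 1 := by omega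
  rw [h7]; rfl

/-- **Curves have isolated singular locus.** On an ambient scheme of dimension `≤ 1` a standard `E` is in the regime of rung
(i-a): `Sing(E) ⊆ V(J) ⊊ Z` is a finite set of closed points. [folklore] -/
theorem regimePlaneIsolated_of_dim_le_one (A : AmbientDatum p K) {E : IdealExponent A.Z} (hE : E.IsStandard)
    (h1 : topologicalKrullDim A.Z ≤ 1) : regimePlaneIsolated A E := by
  haveI := ambient_isIntegral A
  haveI := A.smooth
  haveI := A.quasiCompact
  haveI : IsLocallyNoetherian A.Z := ambient_isLocallyNoetherian A
  haveI : CompactSpace A.Z := QuasiCompact.compactSpace_of_compactSpace A.hom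
  haveI : IsNoetherian A.Z := {}
  have hsupp : (E.J.support : Set A.Z) ≠ Set.univ := by
    intro h
    apply not_mem_support_genericPoint hE.1
    show genericPoint A.Z ∈ (E.J.support : Set A.Z)
    rw [h]; exact Set.mem_univ _
  obtain ⟨hfin, hcl⟩ := Set.finite_and_isClosed_singleton_of_dim_le_one h1 E.J.support.isClosed hsupp
  have hsub := sing_le_support E hE.2
  refine (regimePlaneIsolated_iff A E).mpr ⟨h1.trans (by exact_mod_cast one_le_two), hfin.subset hsub, ?_⟩
  exact fun x hx => hcl x (hsub hx)

end Classification

/-! ## The point measure sum of a surface state -/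

section Measure

variable {p : ℕ} [Fact p.Prime] {K : Type u} [Field K] [CharP K p]

open Classical in
/-- **The point measure sum** `Σ_y μ(y)` of the loose germ measures over the (finitely many, on a surface) points where it is
positive (junk `0` if there are infinitely many). [cite: ZariskiSamuel1960, Appendix 5] -/
def pointMeasureSum (A : AmbientDatum p K) (E : IdealExponent A.Z) : ℕ :=
  if h : {y : A.Z | 0 < looseGermMeasure (A.Z.presheaf.stalk y) (stalkIdeal E.J y) E.b}.Finite then
    ∑ y ∈ h.toFinset, looseGermMeasure (A.Z.presheaf.stalk y) (stalkIdeal E.J y) E.b else 0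

/-- Unfolding the point measure sum. [folklore] -/
theorem pointMeasureSum_eq (A : AmbientDatum p K) (E : IdealExponent A.Z)
    (h : {y : A.Z | 0 < looseGermMeasure (A.Z.presheaf.stalk y) (stalkIdeal E.J y) E.b}.Finite) :
    pointMeasureSum A E = ∑ y ∈ h.toFinset, looseGermMeasure (A.Z.presheaf.stalk y) (stalkIdeal E.J y) E.b := by
  classical
  rw [pointMeasureSum, dif_pos h]

end Measure

/-! ## The laws of the point measure sum (`K : Type`) -/

section Laws

variable {p : ℕ} [Fact p.Prime] {K : Type} [Field K] [CharP K p]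

/-- **Curve steps do not increase the point measure sum**: the blow-up is an isomorphism matching the measures pointwise.
[folklore] -/
theorem pointMeasureSum_le_of_curveCentre (A A' : AmbientDatum p K) (E : IdealExponent A.Z) (hE : E.IsStandard)
    (hdimZ : topologicalKrullDim A.Z ≤ 2) (hdimZ' : topologicalKrullDim A'.Z ≤ 2) {D : Closeds A.Z}
    (hD : E.IsPermissibleCentre A.hom D) {η : A.Z} (hη : IsGenericPoint η (D : Set A.Z))
    (hcoh : Order.coheight η = 1) {π : A'.Z ⟶ A.Z} (hπ : IsBlowup π (vanishingIdeal D))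
    (hE' : (E.transform π D).IsStandard) :
    pointMeasureSum A' (E.transform π D) ≤ pointMeasureSum A E := by
  classical
  set E' := E.transform π D with hE'def
  let μ : A.Z → ℕ := fun y => looseGermMeasure (A.Z.presheaf.stalk y) (stalkIdeal E.J y) E.b
  let μ' : A'.Z → ℕ := fun y' => looseGermMeasure (A'.Z.presheaf.stalk y') (stalkIdeal E'.J y') E'.b
  have hfin := finite_setOf_looseGermMeasure_pos A E hE hdimZ
  have hfin' := finite_setOf_looseGermMeasure_pos A' E' hE' hdimZ'
  rw [pointMeasureSum_eq A E hfin, pointMeasureSum_eq A' E' hfin']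
  show ∑ y' ∈ hfin'.toFinset, μ' y' ≤ ∑ y ∈ hfin.toFinset, μ y
  have hμ : ∀ y', μ' y' = μ (π y') := fun y' => looseGermMeasure_curveStep_eq A A' E hdimZ hD hη hcoh hπ y'
  haveI : IsIso π := isIso_of_curveCentre A A' hη hcoh hπ
  have hinj : Set.InjOn (fun y' : A'.Z => π y') hfin'.toFinset := fun a _ b _ h =>
    π.isOpenEmbedding.injective h
  have hsub : hfin'.toFinset.image (fun y' => π y') ⊆ hfin.toFinset := by
    intro y hy
    obtain ⟨y', hy', rfl⟩ := Finset.mem_image.mp hy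
    rw [Set.Finite.mem_toFinset] at hy' ⊢
    change 0 < μ (π y')
    rw [← hμ]; exact hy'
  calc ∑ y' ∈ hfin'.toFinset, μ' y' = ∑ y' ∈ hfin'.toFinset, μ (π y') :=
        Finset.sum_congr rfl fun y' _ => hμ y'
    _ = ∑ y ∈ hfin'.toFinset.image (fun y' => π y'), μ y := (Finset.sum_image hinj).symm
    _ ≤ ∑ y ∈ hfin.toFinset, μ y := Finset.sum_le_sum_of_subset_of_nonneg hsub fun _ _ _ => Nat.zero_le _

/-- **Non-procrastinating point steps lower the point measure sum**: over the centre `ξ` the fibre measures sum to less than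
`μ(ξ)` (`looseGermMeasure_centre_lt`), off the centre the blow-up is an isomorphism matching measures
(`looseGermMeasure_offCentre_eq`). [cite: ZariskiSamuel1960, Appendix 5] -/
theorem pointMeasureSum_lt_of_pointCentre (A A' : AmbientDatum p K) (E : IdealExponent A.Z) (hE : E.IsStandard)
    (hdimZ : topologicalKrullDim A.Z ≤ 2) (hdimZ' : topologicalKrullDim A'.Z ≤ 2) {ξ : A.Z}
    (hξ : IsClosed ({ξ} : Set A.Z)) (hξS : ξ ∈ E.sing) (hnp : ∀ η ∈ E.sing, η ⤳ ξ → η = ξ)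
    (hdim : ringKrullDim (A.Z.presheaf.stalk ξ) = 2) {π : A'.Z ⟶ A.Z}
    (hπ : IsBlowup π (vanishingIdeal ⟨{ξ}, hξ⟩)) (hE' : (E.transform π ⟨{ξ}, hξ⟩).IsStandard) :
    pointMeasureSum A' (E.transform π ⟨{ξ}, hξ⟩) < pointMeasureSum A E := by
  classical
  set E' := E.transform π ⟨{ξ}, hξ⟩ with hE'def
  let μ : A.Z → ℕ := fun y => looseGermMeasure (A.Z.presheaf.stalk y) (stalkIdeal E.J y) E.b
  let μ' : A'.Z → ℕ := fun y' => looseGermMeasure (A'.Z.presheaf.stalk y') (stalkIdeal E'.J y') E'.b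
  have hfin := finite_setOf_looseGermMeasure_pos A E hE hdimZ
  have hfin' := finite_setOf_looseGermMeasure_pos A' E' hE' hdimZ'
  rw [pointMeasureSum_eq A E hfin, pointMeasureSum_eq A' E' hfin']
  set T := hfin.toFinset with hT
  set T' := hfin'.toFinset with hT'
  show ∑ y' ∈ T', μ' y' < ∑ y ∈ T, μ y
  rw [← Finset.sum_filter_add_sum_filter_not T' (fun y' => π y' = ξ)]
  -- over the centre
  have hcentre : ∑ y' ∈ T'.filter (fun y' => π y' = ξ), μ' y' < μ ξ :=
    looseGermMeasure_centre_lt A A' E ξ hξ π hξS hnp hdim hπ _ fun y' hy' => (Finset.mem_filter.mp hy').2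
  have hξT : ξ ∈ T := by
    rw [hT, Set.Finite.mem_toFinset]
    have h := looseGermMeasure_centre_lt A A' E ξ hξ π hξS hnp hdim hπ ∅ (by simp)
    simpa using h
  -- off the centre
  have hoff : ∀ y' ∈ T'.filter (fun y' => ¬ π y' = ξ), μ' y' = μ (π y') := fun y' hy' =>
    looseGermMeasure_offCentre_eq E hπ fun h => (Finset.mem_filter.mp hy').2 (Set.mem_singleton_iff.mp h)
  have hinj : Set.InjOn (fun y' : A'.Z => π y') (T'.filter (fun y' => ¬ π y' = ξ) : Finset A'.Z) := by
    intro a ha b hb h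
    refine blowup_injOn_off_centre hπ ?_ ?_ h
    · show π a ∈ ((vanishingIdeal (⟨{ξ}, hξ⟩ : Closeds A.Z)).support : Set A.Z)ᶜ
      rw [coe_support_vanishingIdeal]
      exact fun h' => (Finset.mem_filter.mp (Finset.mem_coe.mp ha)).2 (Set.mem_singleton_iff.mp h')
    · show π b ∈ ((vanishingIdeal (⟨{ξ}, hξ⟩ : Closeds A.Z)).support : Set A.Z)ᶜ
      rw [coe_support_vanishingIdeal]
      exact fun h' => (Finset.mem_filter.mp (Finset.mem_coe.mp hb)).2 (Set.mem_singleton_iff.mp h')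
  have hsub : (T'.filter (fun y' => ¬ π y' = ξ)).image (fun y' => π y') ⊆ T.erase ξ := by
    intro y hy
    obtain ⟨y', hy', rfl⟩ := Finset.mem_image.mp hy
    refine Finset.mem_erase.mpr ⟨(Finset.mem_filter.mp hy').2, ?_⟩
    rw [hT, Set.Finite.mem_toFinset]
    change 0 < μ (π y')
    rw [← hoff y' hy']
    have h := (Finset.mem_filter.mp hy').1
    rw [hT', Set.Finite.mem_toFinset] at h
    exact h
  calc ∑ y' ∈ T'.filter (fun y' => π y' = ξ), μ' y' + ∑ y' ∈ T'.filter (fun y' => ¬ π y' = ξ), μ' y'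
      < μ ξ + ∑ y' ∈ T'.filter (fun y' => ¬ π y' = ξ), μ' y' := Nat.add_lt_add_right hcentre _
    _ = μ ξ + ∑ y' ∈ T'.filter (fun y' => ¬ π y' = ξ), μ (π y') := by rw [Finset.sum_congr rfl hoff]
    _ = μ ξ + ∑ y ∈ (T'.filter (fun y' => ¬ π y' = ξ)).image (fun y' => π y'), μ y := by
        rw [Finset.sum_image hinj]
    _ ≤ μ ξ + ∑ y ∈ T.erase ξ, μ y :=
        Nat.add_le_add_left (Finset.sum_le_sum_of_subset_of_nonneg hsub fun _ _ _ => Nat.zero_le _) _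
    _ = ∑ y ∈ T, μ y := Finset.add_sum_erase _ _ hξT

/-! ## The rung -/

/-- [OURS · L1 W4.6 rung (i-b)] NOT a statement of the manuscript. **RUNG (i-b) HOLDS — «procrastination is the only
obstruction on surfaces»**: there is no infinite §2.1-permissible sequence of standard ideal exponents on ambient surfaces
(`topologicalKrullDim Z_k ≤ 2`, every field `K : Type` of characteristic `p`) none of whose steps procrastinates. Proof: the
lexicographic pair (point measure sum, divisorial sum) in the well-founded `ℕ ×ₗ ℕ` drops at every step (point steps:
`pointMeasureSum_lt_of_pointCentre`; curve steps: `pointMeasureSum_le_of_curveCentre` and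
`divisorialSum_transform_lt_of_curveCentre`); in dimension `≤ 1` rung (i-a) (`planeIsolatedFinLocalExitBound_holds`) applies.
[cite: ZariskiSamuel1960, Appendix 5] -/
theorem planeNonProcrastinatingTerminates_holds (p : ℕ) [Fact p.Prime] (K : Type) [Field K] [CharP K p] :
    PlaneNonProcrastinatingTerminates p K := by
  intro r hdim hnp
  -- generic points of the centres
  have hgen : ∀ k, ∃ η : (r.A k).Z, IsGenericPoint η (r.D k : Set (r.A k).Z) := fun k =>
    ⟨_, (r.permissible k).irreducible.isGenericPoint_genericPoint (r.D k).isClosed⟩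
  choose η hη using hgen
  have hηS : ∀ k, η k ∈ (r.E k).sing := fun k => (r.permissible k).subset_sing (hη k).mem
  -- point steps: the centre is the closed point `η k`, and the step does not procrastinate
  have hpt : ∀ k, IsClosed ({η k} : Set (r.A k).Z) → (r.D k : Set (r.A k).Z) = {η k} := fun k hcl =>
    (hη k).def.symm.trans hcl.closure_eq
  have hDeq : ∀ k (hcl : IsClosed ({η k} : Set (r.A k).Z)), r.D k = ⟨{η k}, hcl⟩ := fun k hcl =>
    Closeds.ext (hpt k hcl)
  have hnp' : ∀ k, IsClosed ({η k} : Set (r.A k).Z) → ∀ ζ ∈ (r.E k).sing, ζ ⤳ η k → ζ = η k := by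
    intro k hcl ζ hζS hsp
    by_contra hne
    exact hnp k ⟨η k, ζ, hpt k hcl, hζS, hne, hsp⟩
  -- curve steps: codimension-one generic point
  have hcv : ∀ k, ¬ IsClosed ({η k} : Set (r.A k).Z) → Order.coheight (η k) = 1 := fun k hncl =>
    coheight_eq_one_of_not_isClosed (r.A k) (r.standard k) (hdim k) (r.permissible k) (hη k) hncl
  -- the dimension is constant along the sequence
  have hdimeq : ∀ k, topologicalKrullDim (r.A (k + 1)).Z = topologicalKrullDim (r.A k).Z := by
    intro k
    by_cases hcl : IsClosed ({η k} : Set (r.A k).Z)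
    · have hb := r.blowup k
      rw [hDeq k hcl] at hb
      exact topologicalKrullDim_eq_of_blowup_closedPoint (r.A k) (r.A (k + 1)) hcl
        (maximalIdeal_stalk_ne_bot_of_mem_sing (r.A k) (r.standard k) (hηS k)) hb
    · haveI : IsIso (r.π k) := isIso_of_curveCentre (r.A k) (r.A (k + 1)) (hη k) (hcv k hcl) (r.blowup k)
      exact topologicalKrullDim_eq_of_isIso (r.π k)
  by_cases h1 : topologicalKrullDim (r.A 0).Z ≤ 1
  · -- dimension ≤ 1 at every stage: isolated singular locus, rung (i-a)
    have hall : ∀ k, topologicalKrullDim (r.A k).Z ≤ 1 := by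
      intro k
      induction k with
      | zero => exact h1
      | succ k ih => rw [hdimeq k]; exact ih
    exact planeIsolatedPermissiblyTerminates_of_finLocalExitBound (planeIsolatedFinLocalExitBound_holds p K) r
      fun k => regimePlaneIsolated_of_dim_le_one (r.A k) (r.standard k) (hall k)
  · -- surfaces at every stage
    have hall : ∀ k, topologicalKrullDim (r.A k).Z = 2 := by
      intro k
      induction k with
      | zero => exact withBotENat_eq_two (hdim 0) h1
      | succ k ih => rw [hdimeq k]; exact ih
    -- the lexicographic measure drops at every step
    let Φ : ℕ → ℕ ×ₗ ℕ := fun k => toLex (pointMeasureSum (r.A k) (r.E k), divisorialSum (r.E k).J)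
    have hΦ : ∀ k, Φ (k + 1) < Φ k := by
      intro k
      change toLex (pointMeasureSum (r.A (k + 1)) (r.E (k + 1)), divisorialSum (r.E (k + 1)).J) <
        toLex (pointMeasureSum (r.A k) (r.E k), divisorialSum (r.E k).J)
      rw [Prod.Lex.toLex_lt_toLex]
      have hE' := r.standard (k + 1)
      rw [r.E_succ k] at hE' ⊢
      by_cases hcl : IsClosed ({η k} : Set (r.A k).Z)
      · -- point step
        have hb := r.blowup k
        rw [hDeq k hcl] at hb hE' ⊢
        have hd2 : ringKrullDim ((r.A k).Z.presheaf.stalk (η k)) = 2 := by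
          rw [ringKrullDim_stalk_eq_of_isClosed_ambient (r.A k) hcl, hall k]
        exact Or.inl (pointMeasureSum_lt_of_pointCentre (r.A k) (r.A (k + 1)) (r.E k) (r.standard k) (hdim k)
          (hdim (k + 1)) hcl (hηS k) (hnp' k hcl) hd2 hb hE')
      · -- curve step
        have hcoh := hcv k hcl
        have hle := pointMeasureSum_le_of_curveCentre (r.A k) (r.A (k + 1)) (r.E k) (r.standard k) (hdim k)
          (hdim (k + 1)) (r.permissible k) (hη k) hcoh (r.blowup k) hE'
        have hlt := divisorialSum_transform_lt_of_curveCentre (r.A k) (r.A (k + 1)) (r.E k) (r.standard k)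
          (r.permissible k) (hη k) hcoh (r.blowup k) hE'
        rcases hle.lt_or_eq with h | h
        · exact Or.inl h
        · exact Or.inr ⟨h, hlt⟩
    exact (wellFounded_iff_isEmpty_descending_chain.mp (wellFounded_lt (α := ℕ ×ₗ ℕ))).false ⟨Φ, hΦ⟩

end Laws

end CampaignW46

end Summit.ResolutionOfSingularities.ResolutionOfSingularities.Theorems

end
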